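import Summits.BirchSwinnertonDyer.BirchSwinnertonDyer.Theorems.GenusKolyvaginAtTwoMinimalTwinBSDTwoRouteLedgerLine25
import Summits.BirchSwinnertonDyer.BirchSwinnertonDyer.Theorems.GenusKolyvaginAtTwoMinimalTwinBSDTwoSwappedPairSilentPrime
import HarnessLib

/-!
# Route `GenusKolyvaginAtTwo` (rev 57): the `Δ > 0` cell of U₂ `MinimalTwinBSDTwo` (stmt-BirchSwinnertonDyer-22985) from a PRIME-FRAME
# reversed supply with NO Tamagawa clause, and the all-prime route ledger «WALL + S2″′ + S2⁻′»

Seat `bsd-line-gk2-p3` g28 (PROVER seat 3/3, cell `bsd-f1-sign2`), `--supports stmt-BirchSwinnertonDyer-22985` (helper; closes nothing).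
THEOREMS ONLY (no definition, no named fact, no `sorry`); standard axioms.  **BSD is NOT proved by this file; U₂ / hTw0 / hTw1 / the wall /
the supplies are NOT proved; no item is closed.**  Everything is CONDITIONAL on the displayed hypotheses (route items as in `closes` rev 57,
the wall, the two reversed supplies — beyond print as stated — and the four STATEMENT-ONLY print facts GZ / GZK / modularity / Milne).

THE POINT.  On each cell `closes` consumes, the reversed `2`-Selmer-trivial Heegner twin supply can be asked on a PRIME Heegner field
`K = ℚ(√−ℓ)` with the Tamagawa side condition made AUTOMATIC by the frame: on `hTw1 = (Δ < 0, ord₂ C = 1)` the one transposition bit is forced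
(`OneBit.padicValNat_two_tamagawaProduct_twin_eq_succ_of_discr_eq_neg_prime`, p767140: `ord₂ C(Wd) = ord₂ C(W) + 1`), on `hTw2 = (Δ > 0,
ord₂ C = 2)` (LINE 24's cell, not consumed by rev 57) silence is «cubic without a root mod `ℓ`» (`Silent.…_of_noRoot`, p767915), and — this
file — on `hTw0 = (Δ > 0, ord₂ C = 0)` the SAME no-root clause makes the twist silent, `ord₂ C(Wd) = ord₂ C(W) = 0`, so LINE 23 v1.3's S2″
budget clause holds for free and g23's Manin-free engine applies.  (On `Δ > 0` with `C(W)` odd and `d_K = −ℓ` the parity law leaves the cubic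
`0` or `3` roots mod `ℓ`; «no root» = «not totally split».)

* §1 **`hTw0_of_slicedWall_of_reversedSupplyExponentPrime_of_facts`** — `hTw0 ⟸ S1⁺ + S2″′ + PRINT`: S1⁺ := `BSD₂` for non-CM globally
  minimal `W` with `r_an = 0`, `#Sel₂ = 1`, `0 < Δ`, `ord₂ C = 0`; S2″′ := for `W` non-CM, `r_an = 1`, `#Sel₂ = 2`, `0 < Δ`, `ord₂ C(W) = 0`:
  an imaginary quadratic `K`, **`d_K = −ℓ` (`ℓ` prime) with the `2`-division cubic `4x³ + b₂x² + 2b₄x + b₆` of the minimal model rootless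
  mod `ℓ`**, `d_K` odd `≠ −3`, Heegner for `N_W`; a datum (`c ≠ 0`); `P(1)` of infinite order with **`2^(ord₂ c) ∥ P(1)`** in `E(K[1])`; a
  globally minimal `2`-Selmer-trivial twin `Wd ≅ E^(d_K)` — no Tamagawa clause.
* §2 **`nonCMAtTwo_of_items_of_wall_of_reversedSuppliesPrime_line25`** — `closes` (rev 57) with `hTw` REPLACED by S1 (LINE 23's anchor
  `MinimalRankZeroBSDTwo` verbatim) + S2″′ + S2⁻′ (p767140's binder `hS2p` verbatim): **U₂|`closes` ⟸ WALL + two PRIME-FRAME reversed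
  supplies with lossless exponent clauses (`2^(ord₂ c) ∥ P(1)` on `Δ > 0`, `2^(ord₂ c + 1) ∥ P(1)` on `Δ < 0`) and NO Tamagawa clause + PRINT** —
  the U₂-side counterpart of the LEAD's prime-frame kernel items.

References: [GrossZagier1986] V.§2 (2.2); [GrossLMS1991] §3 (3.3), §5; [Kramer1981] Thm. 1, §2 Prop. 3; [Milne1972ArithmeticAV] §1 Thm. 1;
[SilvermanAEC2009] III.1 Table 3.1; [Miller2011LMS] Def. 1.1.
-/

set_option autoImplicit false
set_option linter.dupNamespace false -- `Summit.<P>.<Sub>` repeats `BirchSwinnertonDyer` (D-0017)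

noncomputable section

open scoped Classical

open WeierstrassCurve NumberField Literature.NumberTheory.EllipticCurves
  Literature.NumberTheory.EllipticCurves.ModularForms
  Literature.NumberTheory.EllipticCurves.Rank1Residual
  Literature.NumberTheory.EllipticCurves.Rank1Residual.Typed
  Literature.NumberTheory.EllipticCurves.KrizLi2019
  Summit.BirchSwinnertonDyer.Rank1Residual
  Summit.BirchSwinnertonDyer.Rank1Residual.AdditivePotMult
  Summit.BirchSwinnertonDyer.BirchSwinnertonDyer.Rank1Residual
  Summit.BirchSwinnertonDyer.BirchSwinnertonDyer.Theses.GenusKolyvaginAtTwo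
  Summit.BirchSwinnertonDyer.BirchSwinnertonDyer.Theorems.CMExactDescent
  Summit.BirchSwinnertonDyer.BirchSwinnertonDyer.Theorems.GenusExact.TwinSwap
  Summit.BirchSwinnertonDyer.BirchSwinnertonDyer.Theorems.GenusExact.TwinSwap.OneBit
  Summit.BirchSwinnertonDyer.BirchSwinnertonDyer.Theorems.GenusExact.PlusDescent

namespace Summit.BirchSwinnertonDyer.BirchSwinnertonDyer.Theorems.GenusExact.TwinSwap.Ledger.Line25

/-! ## §1 The `Δ > 0` cell `hTw0` from the sliced wall, the PRIME-FRAME reversed supply S2″′ and PRINT -/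

/-- **`hTw0 ⟸ S1⁺ + S2″′ + PRINT` on the prime frame.**  With `hS1pos` — the rank-`0` wall SLICED to the cell (`r_an = 0`, `#Sel₂ = 1`, `0 < Δ`,
`ord₂ C = 0`) — and `hS2ep` — S2″′: for `W` non-CM,
`r_an = 1`, `#Sel₂ = 2`, `0 < Δ`, `ord₂ C(W) = 0`: an imaginary quadratic `K` with **`d_K = −ℓ`, `ℓ` prime, and the `2`-division cubic
`4x³ + b₂x² + 2b₄x + b₆` of the minimal model without a root mod `ℓ`**, `d_K` odd `≠ −3`, Heegner for `N_W`; a datum `Dt` (`c ≠ 0`); a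
conductor-`1` datum with `P(1)` of infinite order and **`2^(ord₂ c) ∥ P(1)`** in `E(K[1])`; a globally minimal `2`-Selmer-trivial twin
`Wd ≅ E^(d_K)` — NO Tamagawa clause — and the four PRINT facts: **every `W` on `hTw0 = (Δ > 0, ord₂ C = 0)` satisfies `BSD₂`**.  The twist is
silent (`Silent.padicValNat_two_tamagawaProduct_twin_eq_of_discr_eq_neg_prime_of_noRoot`: `ord₂ C(Wd) = ord₂ C(W) = 0`, unconditional), the
twin is non-CM (same `j`) of analytic rank `0` (g23's `analyticRank_twist_eq_zero_of_rankOne`), `Δ(Wd) > 0`, so `BSD₂(Wd)` by S1⁺, and g23's Manin-free engine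
`swappedPairDescentAtTwo_maninExponent_of_facts` (p766443) transfers it.  CONDITIONAL on the displayed hypotheses; BSD is NOT proved; nothing
is closed.  [cite: GrossZagier1986, V.§2 (2.2)] [cite: Milne1972ArithmeticAV, §1 Thm. 1] [cite: Kramer1981, §2 Prop. 3]
[cite: Miller2011LMS, Def. 1.1] -/
theorem hTw0_of_slicedWall_of_reversedSupplyExponentPrime_of_facts
    (hGZ : ∀ (N : ℕ) [NeZero N] (W : WeierstrassCurve ℚ) (K : Type) [Field K] [NumberField K], gross_zagier N W K)
    (hGZK : rank_eq_analyticRank_of_analyticRank_le_one) (hmod : hasEntireLFunction_rat)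
    (hMilneC : Milne1972.bsdQuotient_baseChange_quadratic_anyModel)
    (hS1pos : ∀ (W : WeierstrassCurve ℚ) [W.IsElliptic] [W.IsGloballyMinimal],
      ¬ W.HasCM → W.analyticRank = 0 → Nat.card (W.selmerGroup 2) = 1 → 0 < W.Δ → padicValNat 2 W.tamagawaProduct = 0 → BSDp W 2)
    (hS2ep : ∀ (W : WeierstrassCurve ℚ) [W.IsElliptic] [W.IsGloballyMinimal] [NeZero (W.conductorNorm ℤ)],
      ¬ W.HasCM → W.analyticRank = 1 → Nat.card (W.selmerGroup 2) = 2 → 0 < W.Δ → padicValNat 2 W.tamagawaProduct = 0 →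
      ∃ (K : Type) (_ : Field K) (_ : NumberField K),
        IsImaginaryQuadratic K ∧
        (∃ ℓ : ℕ, ℓ.Prime ∧ NumberField.discr K = -(ℓ : ℤ) ∧
          ∀ x : ZMod ℓ, 4 * x ^ 3 + ((integralModelInt W).b₂ : ZMod ℓ) * x ^ 2 +
            2 * ((integralModelInt W).b₄ : ZMod ℓ) * x + ((integralModelInt W).b₆ : ZMod ℓ) ≠ 0) ∧
        Odd (NumberField.discr K) ∧ NumberField.discr K ≠ -3 ∧ SatisfiesHeegnerHypothesis (W.conductorNorm ℤ) K ∧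
        ∃ (Dt : ModularParametrizationData W (W.conductorNorm ℤ)) (β : ℤ) (ι : K →+* ℂ) (d₁ : KolyvaginHeegnerData Dt β ι 1),
          Dt.c ≠ 0 ∧ ¬ IsOfFinAddOrder d₁.derivedPoint ∧
          (∃ Q : (W.baseChange (ringClassField K ι 1)).toAffine.Point,
            ((2 ^ (padicValInt 2 Dt.c) : ℕ) : ℤ) • Q = d₁.derivedPoint) ∧
          (¬ ∃ Q : (W.baseChange (ringClassField K ι 1)).toAffine.Point,
            ((2 ^ (padicValInt 2 Dt.c + 1) : ℕ) : ℤ) • Q = d₁.derivedPoint) ∧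
          ∃ (Wd : WeierstrassCurve ℚ) (_ : Wd.IsElliptic) (_ : Wd.IsGloballyMinimal),
            (∃ C : WeierstrassCurve.VariableChange ℚ, C • W.quadraticTwist (NumberField.discr K : ℚ) = Wd) ∧
            Nat.card (Wd.selmerGroup 2) = 1) :
    ∀ (W : WeierstrassCurve ℚ) [W.IsElliptic] [W.IsGloballyMinimal], ¬ W.HasCM → W.analyticRank = 1 →
      Nat.card (W.selmerGroup 2) = 2 → 0 < W.Δ → padicValNat 2 W.tamagawaProduct = 0 → BSDp W 2 := by
  intro W _ _ hcm hr hSel hΔ hC0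
  haveI : NeZero (W.conductorNorm ℤ) := ⟨(W.conductorNorm_pos_holds).ne'⟩
  have hT : Odd W.tamagawaProduct := by
    rcases Nat.even_or_odd W.tamagawaProduct with h | h
    · exfalso
      have h2 : 2 ∣ W.tamagawaProduct := even_iff_two_dvd.mp h
      have h1 : 1 ≤ padicValNat 2 W.tamagawaProduct :=
        one_le_padicValNat_of_dvd W.tamagawaProduct_pos_holds.ne' h2
      omega
    · exact h
  obtain ⟨K, iF, iN, hK, ⟨ℓ, hℓ, hdℓ, hnoRoot⟩, hodd, h3, hH, Dt, β, ι, d₁, hc0, hy, hdiv, hndiv, Wd, iE, iM, hWd, hSel1⟩ :=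
    hS2ep W hcm hr hSel hΔ hC0
  haveI hEK : (W.baseChange K).IsElliptic := isElliptic_baseChange' W K
  have hD0 : (NumberField.discr K : ℚ) ≠ 0 := by exact_mod_cast NumberField.discr_ne_zero K
  haveI hEt : (W.quadraticTwist (NumberField.discr K : ℚ)).IsElliptic := W.isElliptic_quadraticTwist hD0
  obtain ⟨Cd, hCd⟩ := hWd
  -- the twist is silent on this frame: `ord₂ C(Wd) = ord₂ C(W) = 0`
  have hTam : padicValNat 2 Wd.tamagawaProduct = 0 := by
    rw [Silent.padicValNat_two_tamagawaProduct_twin_eq_of_discr_eq_neg_prime_of_noRoot W hK hodd hH hℓ hdℓ hnoRoot Cd hCd, hC0]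
  -- the twin is non-CM (same `j`) of analytic rank `0`: `BSD₂(Wd)` from S1
  have hcmd : ¬ Wd.HasCM := by
    rw [← hCd, hasCM_iff_of_j_eq (((W.quadraticTwist (NumberField.discr K : ℚ)).variableChange_j Cd).trans (W.j_quadraticTwist hD0))]
    exact hcm
  obtain ⟨P₀, Hd, hP₀, hP₀K⟩ := exists_heegnerPoint_map_eq_derivedPoint_one hK hH d₁
  have hPinf : ¬ IsOfFinAddOrder P₀ := by
    intro hfin
    apply hy
    rw [← hP₀K]
    exact (WeierstrassCurve.Affine.Point.map (W' := W)
      (algebraMap K (ringClassField K ι 1)).toRatAlgHom).isOfFinAddOrder hfin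
  have hrt : (W.quadraticTwist (NumberField.discr K : ℚ)).analyticRank = 0 :=
    analyticRank_twist_eq_zero_of_rankOne W K (hGZ _ W K) hmod hK hH hr ⟨Dt, Hd, ι, hP₀⟩ hPinf
  have hrd : Wd.analyticRank = 0 := by rw [← hCd, analyticRank_smul, hrt]
  have hΔd : 0 < Wd.Δ := (Δ_twin_pos_iff W hD0 Cd hCd).mpr hΔ
  have hBd : BSDp Wd 2 := hS1pos Wd hcmd hrd hSel1 hΔd hTam
  exact swappedPairDescentAtTwo_maninExponent_of_facts hGZ hGZK hmod hMilneC W hr hSel hT K hK hodd h3 hH Dt hc0 β ι d₁ hy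
    (padicValInt 2 Dt.c) rfl hdiv hndiv Wd ⟨Cd, hCd⟩ hSel1 (Or.inr hTam) hBd

/-! ## §2 `closes` (rev 57) with U₂ replaced by the wall and two PRIME-FRAME reversed supplies S2″′, S2⁻′ -/

/-- **THE ROUTE LEDGER ON REV 57, PRIME FRAMES: U₂ ↦ «WALL + S2″′ + S2⁻′».**  `Line25.nonCMAtTwo_of_items_of_tamagawaSlicedTwin_line25`
(= `closes` rev 57 with `hTw` sliced) with `hTw0` fed by §1 (S1 restricted to S1⁺, + S2″′ + PRINT) and `hTw1` by
`OneBit.hTw1_of_wall_of_reversedSupplyDepthOnePrime_of_facts` (S1 + S2⁻′ + PRINT, p767140): both reversed `2`-Selmer-trivial Heegner twin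
supplies live on PRIME Heegner fields `ℚ(√−ℓ)`, carry the lossless exponent clauses `2^(ord₂ c) ∥ P(1)` resp. `2^(ord₂ c + 1) ∥ P(1)`, and NO
Tamagawa clause (silent: cubic without a root mod `ℓ`; one bit: automatic on `Δ < 0`).  CONDITIONAL on the displayed hypotheses (route items,
the wall S1, the two supplies — beyond print as stated); proves nothing about BSD by itself; closes no item.
[cite: GrossZagier1986, V.§2 (2.2)] [cite: Kramer1981, Thm. 1, §2 Prop. 3] [cite: Miller2011LMS, Def. 1.1] -/
theorem nonCMAtTwo_of_items_of_wall_of_reversedSuppliesPrime_line25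
    (hP : GenusPrimitiveSupplyAtTwoPosDiscShallow) (hPG : GenusDeepSupplyAtTwoNegDiscNarrow) (hQ1 : CyclicTorsionOfNegDisc)
    (hQ2 : KolyvaginRelationAtTwo)
    (hQ5R : EquivariantChebotarevAtTwoR) (hQ3RT : EquivariantKolyvaginExactAtTwoRT)
    (hQ4T : KolyvaginExactAtTwoPosDiscT) (hGf : ExactDescentAtTwoOfFourFacts)
    (hR : OffHabitatResidualAtTwo) (hOff : OffCutResidualAtTwoR)
    (hK1P : K1Pos) (hK1N : K1Neg) (hSha1 : ShaVanishingAtDepthZeroAtTwo)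
    (hS1 : ∀ (W : WeierstrassCurve ℚ) [W.IsElliptic] [W.IsGloballyMinimal],
      ¬ W.HasCM → W.analyticRank = 0 → Nat.card (W.selmerGroup 2) = 1 → BSDp W 2)
    (hS2ep : ∀ (W : WeierstrassCurve ℚ) [W.IsElliptic] [W.IsGloballyMinimal] [NeZero (W.conductorNorm ℤ)],
      ¬ W.HasCM → W.analyticRank = 1 → Nat.card (W.selmerGroup 2) = 2 → 0 < W.Δ → padicValNat 2 W.tamagawaProduct = 0 →
      ∃ (K : Type) (_ : Field K) (_ : NumberField K),
        IsImaginaryQuadratic K ∧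
        (∃ ℓ : ℕ, ℓ.Prime ∧ NumberField.discr K = -(ℓ : ℤ) ∧
          ∀ x : ZMod ℓ, 4 * x ^ 3 + ((integralModelInt W).b₂ : ZMod ℓ) * x ^ 2 +
            2 * ((integralModelInt W).b₄ : ZMod ℓ) * x + ((integralModelInt W).b₆ : ZMod ℓ) ≠ 0) ∧
        Odd (NumberField.discr K) ∧ NumberField.discr K ≠ -3 ∧ SatisfiesHeegnerHypothesis (W.conductorNorm ℤ) K ∧
        ∃ (Dt : ModularParametrizationData W (W.conductorNorm ℤ)) (β : ℤ) (ι : K →+* ℂ) (d₁ : KolyvaginHeegnerData Dt β ι 1),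
          Dt.c ≠ 0 ∧ ¬ IsOfFinAddOrder d₁.derivedPoint ∧
          (∃ Q : (W.baseChange (ringClassField K ι 1)).toAffine.Point,
            ((2 ^ (padicValInt 2 Dt.c) : ℕ) : ℤ) • Q = d₁.derivedPoint) ∧
          (¬ ∃ Q : (W.baseChange (ringClassField K ι 1)).toAffine.Point,
            ((2 ^ (padicValInt 2 Dt.c + 1) : ℕ) : ℤ) • Q = d₁.derivedPoint) ∧
          ∃ (Wd : WeierstrassCurve ℚ) (_ : Wd.IsElliptic) (_ : Wd.IsGloballyMinimal),
            (∃ C : WeierstrassCurve.VariableChange ℚ, C • W.quadraticTwist (NumberField.discr K : ℚ) = Wd) ∧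
            Nat.card (Wd.selmerGroup 2) = 1)
    (hS2p : ∀ (W : WeierstrassCurve ℚ) [W.IsElliptic] [W.IsGloballyMinimal] [NeZero (W.conductorNorm ℤ)],
      ¬ W.HasCM → W.analyticRank = 1 → Nat.card (W.selmerGroup 2) = 2 → W.Δ < 0 → padicValNat 2 W.tamagawaProduct = 1 →
      ∃ (K : Type) (_ : Field K) (_ : NumberField K),
        IsImaginaryQuadratic K ∧ (∃ ℓ : ℕ, ℓ.Prime ∧ NumberField.discr K = -(ℓ : ℤ)) ∧ Odd (NumberField.discr K) ∧
        NumberField.discr K ≠ -3 ∧ SatisfiesHeegnerHypothesis (W.conductorNorm ℤ) K ∧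
        ∃ (Dt : ModularParametrizationData W (W.conductorNorm ℤ)) (β : ℤ) (ι : K →+* ℂ) (d₁ : KolyvaginHeegnerData Dt β ι 1),
          Dt.c ≠ 0 ∧ ¬ IsOfFinAddOrder d₁.derivedPoint ∧
          (∃ Q : (W.baseChange (ringClassField K ι 1)).toAffine.Point,
            ((2 ^ (padicValInt 2 Dt.c + 1) : ℕ) : ℤ) • Q = d₁.derivedPoint) ∧
          (¬ ∃ Q : (W.baseChange (ringClassField K ι 1)).toAffine.Point,
            ((2 ^ (padicValInt 2 Dt.c + 1 + 1) : ℕ) : ℤ) • Q = d₁.derivedPoint) ∧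
          ∃ (Wd : WeierstrassCurve ℚ) (_ : Wd.IsElliptic) (_ : Wd.IsGloballyMinimal),
            (∃ C : WeierstrassCurve.VariableChange ℚ, C • W.quadraticTwist (NumberField.discr K : ℚ) = Wd) ∧
            Nat.card (Wd.selmerGroup 2) = 1)
    (hL : EntireLFunctionRat)
    (hGZ : GrossZagierAllLevels) (hGZK : MultPublishedInputsAtTwo) (hMi : MilneAnyModel) :
    NonCMAtTwo :=
  nonCMAtTwo_of_items_of_tamagawaSlicedTwin_line25 hP hPG hQ1 hQ2 hQ5R hQ3RT hQ4T hGf hR hOff hK1P hK1N hSha1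
    (hTw0_of_slicedWall_of_reversedSupplyExponentPrime_of_facts hGZ hGZK hL hMi (fun W _ _ hcm hr hSel _ _ ↦ hS1 W hcm hr hSel) hS2ep)
    (hTw1_of_wall_of_reversedSupplyDepthOnePrime_of_facts hGZ hGZK hL hMi hS1 hS2p) hL hGZ hGZK hMi


end Summit.BirchSwinnertonDyer.BirchSwinnertonDyer.Theorems.GenusExact.TwinSwap.Ledger.Line25

end
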